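import Summits.HodgeConjecture.HodgeConjecture.Theses.AnchorTransport
import Literature.AlgebraicGeometry.FundamentalGroup.RiemannExistenceSmoothAffine
import HarnessLib

/-!
# Crux `AnchorExistence` (stmt-HodgeConjecture-1077), line `qbar_fibre_anchors` — registered stub C
# `stub_riemannExistenceQbarDescent`, CLOSED BY NAME

Route `AnchorTransport` of `HodgeConjecture`. The registered skeleton
`Cruxes/AnchorExistence/Lines/qbar_fibre_anchors.lean` (lead c5, skeleton v4) carries four sorried stubs;
stub C is, BY NAME, the Literature named fact

  `Literature.AlgebraicGeometry.FundamentalGroup.riemannExistence_qbarDescent_of_finiteIndex`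

(Riemann existence with `ℚ̄`-descent of finite-index subgroups of `π₁`: SGA 1 XII Thm. 5.1 + XIII Cor. 4.6).
That fact is a THEOREM of the tree since 2026-08-17
(`FundamentalGroup.riemannExistence_qbarDescent_of_finiteIndex_holds`,
`Literature/AlgebraicGeometry/FundamentalGroup/RiemannExistenceSmoothAffine.lean`: the algebraic half
`riemannExistence_qbarDescent_of_finiteIndex_of_locallyAlgebraicSeparating` + the transcendental half
`SmoothAffine.exists_locallyAlgebraicSeparating`), landed eight minutes AFTER the skeleton was registered and
never credited to the stub. This file records the stub VERBATIM (registered signature = the fact's name) so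
that the crux's ledger entry carries the credit; no mathematics beyond the citation of the tree theorem.

## References

* [SGA1] A. Grothendieck, M. Raynaud, Revêtements étales et groupe fondamental (SGA 1), LNM 224 (1971),
  Exp. XII Thm. 5.1, Exp. XIII Cor. 4.6.
-/

noncomputable section

-- `Summit.HodgeConjecture.HodgeConjecture.…` is the mandated namespace (single-conjunct summit).
set_option linter.dupNamespace false

namespace Summit.HodgeConjecture.HodgeConjecture.Theorems

/-- **Registered stub `stub_riemannExistenceQbarDescent` of the line `qbar_fibre_anchors`** (crux
`AnchorExistence`, stmt-HodgeConjecture-1077), verbatim: Riemann existence with `ℚ̄`-descent of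
finite-index subgroups — every finite-index subgroup of `π₁^top(S(ℂ), s)`, `S/ℚ̄` a smooth irreducible
quasi-projective variety, is realised by a finite étale cover of `S_ℂ` defined over `ℚ̄`. Discharged by the
tree theorem `FundamentalGroup.riemannExistence_qbarDescent_of_finiteIndex_holds`.
[cite: SGA1, Exp. XII Thm. 5.1 and Exp. XIII Cor. 4.6] -/
theorem stub_riemannExistenceQbarDescent :
    Literature.AlgebraicGeometry.FundamentalGroup.riemannExistence_qbarDescent_of_finiteIndex :=
  Literature.AlgebraicGeometry.FundamentalGroup.riemannExistence_qbarDescent_of_finiteIndex_holds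

end Summit.HodgeConjecture.HodgeConjecture.Theorems

end
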